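import Literature.Probability.RandomPlanarGeometry.LoopConfigurations
import Mathlib.MeasureTheory.Measure.LevyProkhorovMetric
import Mathlib.MeasureTheory.Constructions.BorelSpace.Basic
import HarnessLib

/-!
# Locally finite typed loop configurations: DKKMO's space `(C, d_CN)` as a metric space

Fifth step (after `UnbasedLoops`, `UnbasedLoopSpace`, `LoopConfigurations`,
`LoopConfigurationsMetric`) of the paper-form objects of Duminil-Copin–Kozlowski–Krachun–
Manolescu–Oulamara, *Rotational invariance in critical planar lattice models*, arXiv:2012.11672v2,
§1.2. The file `LoopConfigurations` defines the *typed loop configurations* `LoopConfig E`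
(DKKMO's `F = F₀ ⊔ F₁`), the printed relation `d_CN(F, F') ≤ ε` (`LoopConfig.IsClose ε`, with the
soft window `B(0, 1/ε)` and the unbased unoriented loop distance `d` of eq. (1),
`UnbasedLoop.udist`, per type), the extended-real `d_CN = LoopConfig.cnEDist` and the coupling
distance of laws `LoopConfig.cnLawEDist` (eq. (2)), but puts no topology and no σ-algebra on
configurations. This file supplies them.

## What is true, and what this file provides

* `d_CN` itself is **not** a metric on `C`: the soft window `B(0, 1/ε)` makes it sub-additive
  only at small scales (`LoopConfig.IsClose.trans` needs `ε + ε' ≤ 1`; for `ε, ε' ≈ 0.8` the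
  triangle inequality genuinely fails). The standard remedy, which changes nothing below scale
  `1` (and nothing at all for the coupling distance of probability laws, which is `≤ 1`,
  `LoopConfig.cnLawEDist_le_one`), is the **truncation `min (d_CN) 1`**: this is a
  pseudo-extended-metric on all of `LoopConfig E` (`LoopConfig.min_cnEDist_one_triangle`). We
  register it as the (pseudo-e)metric structure of `LoopConfig E` (`LoopConfig.edist_def :
  edist c c' = min (cnEDist c c') 1`, `dist c c' = (min (cnEDist c c') 1).toReal`), together
  with its Borel σ-algebra; `edist c c' < ENNReal.ofReal ε ↔ cnEDist c c' < ENNReal.ofReal ε`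
  for `ε ≤ 1` (`LoopConfig.edist_lt_ofReal_iff`), so balls, convergence, Cauchy sequences and
  uniform structure are those of the printed `d_CN`.
* `d_CN(F, F') = 0` does not force `F = F'`: `d_CN` only sees members through the unoriented
  distance `d` (so reversing members is invisible) and only up to closure. On configurations
  that are **closed under reversal of members**, have **no point loops** and are **locally
  finite** — in every window `B(0, r)` only finitely many members of each type have diameter
  `≥ ε`, for every `ε > 0` (the Camia–Newman / Sheffield reading of DKKMO's "locally finite
  families", the one that survives scaling limits; lattice configurations even have finitely
  many members in every window) — it does (`LoopConfig.ext_of_cnEDist_eq_zero`). These form the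
  structure `LocFinLoopConfig E` (the requested notion: DKKMO's `C`, arXiv:2012.11672v2 §1.2,
  minus the non-crossing conditions, which play no role for the metric), a genuine **metric
  space** under `min (d_CN) 1` with its Borel σ-algebra, isometrically embedded
  (`LocFinLoopConfig.toLoopConfig`, `LocFinLoopConfig.toCN`) both in `LoopConfig E` and in the
  metric quotient `CNLoopSpace E := SeparationQuotient (LoopConfig E)` ("configurations modulo
  `d_CN = 0`", a metric space containing the non-locally-finite limits as well).
* **Laws.** A random configuration `X : Ω → LoopConfig E` under `μ` has the law
  `μ.map X` (a Borel measure on `LoopConfig E`) and `μ.map (LoopConfig.toCN ∘ X)` on the metric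
  space `CNLoopSpace E`. The coupling distance of eq. (2) dominates the **Lévy–Prokhorov
  distance** of the laws (`LoopConfig.levyProkhorovEDist_map_le_cnLawEDist`, and `_toCN_` for
  the quotient): a coupling with `P[d_CN > ε] < ε` is exactly a Ky Fan–Strassen witness. Hence
  `cnLawEDist → 0` forces Lévy–Prokhorov convergence, which implies weak convergence of
  probability laws (Mathlib: `MeasureTheory.LevyProkhorov.continuous_equiv_probabilityMeasure` /
  `LevyProkhorov.le_convergenceInDistribution`), and Prokhorov's theorem is available on the
  Hausdorff space `CNLoopSpace E` (Mathlib: `isCompact_closure_of_isTightMeasureSet`, which needs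
  neither completeness nor separability).
* **Not provided here (and partly false as folklore would have it).** (i) `LocFinLoopConfig E`
  is *not* complete: `n` concentric circles of radii `1 + 1/k`, `k ≤ n`, form a `d_CN`-Cauchy
  sequence with no locally finite limit; its completion is (a closed part of) `CNLoopSpace E`,
  whose completeness for complete `E` is the analogue of the completeness of the Hausdorff
  hyperspace and is not proved in this file. (ii) Neither `LoopConfig E` nor `CNLoopSpace E` is
  separable (`2^ℵ₀` configurations of pairwise `1`-separated loops in `B(0, 1)` are pairwise at
  distance `≥ 1/2`); separability of `LocFinLoopConfig E` for separable `E` is expected but not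
  proved here. (iii) The converse bound "Lévy–Prokhorov small ⇒ `cnLawEDist` small" is
  Strassen's theorem and is not proved; only the direction used to transfer limits along
  DKKMO's theorems is.

## Contents (namespace `Literature.Probability.RandomPlanarGeometry`)

* `UnbasedLoop.diam_range_le_of_udist_le` (diameters of traces move by at most `2 d`).
* `LoopConfig.min_cnEDist_one_triangle`; instances `LoopConfig.instPseudoMetricSpace`
  (`edist = min cnEDist 1`), `instMeasurableSpace` (Borel), `instBorelSpace`;
  `edist_def`, `dist_def`, `edist_le_one`, `edist_lt_ofReal_iff`, `isClose_of_edist_lt`,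
  `edist_le_ofReal_of_isClose`, `edist_eq_zero_iff`, `inseparable_iff_cnEDist_eq_zero`.
* `LoopConfig.IsReversalClosed`, `LoopConfig.reversalClosure` (+ `isClose_reversalClosure_left/
  right`, `cnEDist_reversalClosure_left/right`, `edist_reversalClosure_eq_zero`),
  `LoopConfig.IsLocallyFinite` (window/diameter form; `of_finite_window`),
  `LoopConfig.ext_of_cnEDist_eq_zero` (separation).
* `CNLoopSpace E := SeparationQuotient (LoopConfig E)`, `LoopConfig.toCN`, `toCN_eq_toCN_iff`.
* `LocFinLoopConfig E` (structure extending `LoopConfig E`), instances `instMetricSpace`,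
  `instMeasurableSpace`, `instBorelSpace`; `isometry_toLoopConfig`, `toLoopConfig_injective`,
  `measurable_toLoopConfig`, `toCN`, `toCN_injective`, `isometry_toCN`; the constructor
  `LocFinLoopConfig.ofLoopConfig` (reversal closure of a locally finite configuration without
  point loops) with `edist_ofLoopConfig_eq_zero`, `toCN_ofLoopConfig`.
* `LoopConfig.levyProkhorovEDist_map_le_cnLawEDist`,
  `LoopConfig.levyProkhorovEDist_map_toCN_le_cnLawEDist`.

## References

* H. Duminil-Copin, K. K. Kozlowski, D. Krachun, I. Manolescu, M. Oulamara, arXiv:2012.11672v2,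
  §1.2 (the space `C`, `d_CN`, eq. (1)–(2)). [arXiv201211672v2]
* F. Camia, C. M. Newman, Comm. Math. Phys. 268 (2006), §2.2 (spaces of curves and of closed
  collections of curves; Hausdorff-type distance; "locally finite": finitely many loops of
  diameter `> ε` in bounded regions). [CamiaNewman2006]
* M. Aizenman, A. Burchard, Duke Math. J. 99 (1999), §2.1 (curves modulo reparametrisation,
  tightness). [AizenmanBurchard1999]
* R. M. Dudley, *Real Analysis and Probability* (2002), §11.3 (Prokhorov and Ky Fan metrics;
  Thm. 11.3.5: `ρ ≤ α`), §11.6 (Strassen).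
-/

noncomputable section

open Set MeasureTheory Metric
open scoped ENNReal Topology

namespace Literature.Probability.RandomPlanarGeometry

/-! ### Diameters of traces under the loop distance `d` -/

namespace UnbasedLoop

variable {E : Type*} [MetricSpace E]

/-- Traces of loops at `d`-distance `r` have diameters differing by at most `2r`:
`diam u ≤ diam v + 2 d(u, v)` (every point of either trace is within `d(u, v)` of the other
trace). [folklore] -/
theorem diam_range_le_of_udist_le (u v : UnbasedLoop E) {r : ℝ} (h : u.udist v ≤ r) :
    diam u.range ≤ diam v.range + 2 * r := by
  have hr : 0 ≤ r := (udist_nonneg u v).trans h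
  refine diam_le_of_forall_dist_le (by positivity) fun x hx y hy ↦ ?_
  obtain ⟨x', hx', hxx'⟩ := exists_mem_range_dist_le u v hx
  obtain ⟨y', hy', hyy'⟩ := exists_mem_range_dist_le u v hy
  have hb : Bornology.IsBounded v.range := v.isCompact_range.isBounded
  calc dist x y ≤ dist x x' + dist x' y' + dist y' y := dist_triangle4 x x' y' y
    _ ≤ r + diam v.range + r := by
        gcongr
        · exact hxx'.trans h
        · exact dist_le_diam_of_mem hb hx' hy'
        · rw [dist_comm]; exact hyy'.trans h
    _ = diam v.range + 2 * r := by ring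

end UnbasedLoop

namespace LoopConfig

variable {E : Type*} [NormedAddCommGroup E]

/-! ### The truncated distance `min (d_CN) 1` is a pseudo-extended-metric -/

/-- **Triangle inequality for the truncation `min (d_CN) 1`.** Below scale `1` this is the
restricted triangle inequality of `d_CN` (`IsClose.trans`, `cnEDist_le_add_of_lt`); at or above
scale `1` the truncation makes it automatic. (Untruncated, `d_CN` violates the triangle
inequality at scales `≈ 1` because of the soft window `B(0, 1/ε)`.) [folklore] -/
theorem min_cnEDist_one_triangle (c c' c'' : LoopConfig E) :
    min (cnEDist c c'') 1 ≤ min (cnEDist c c') 1 + min (cnEDist c' c'') 1 := by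
  by_cases h : 1 ≤ min (cnEDist c c') 1 + min (cnEDist c' c'') 1
  · exact (min_le_right _ _).trans h
  push Not at h
  have ha : cnEDist c c' < 1 := by
    rcases min_lt_iff.1 (lt_of_le_of_lt le_self_add h) with h' | h'
    · exact h'
    · exact absurd h' (lt_irrefl _)
  have hb : cnEDist c' c'' < 1 := by
    rcases min_lt_iff.1 (lt_of_le_of_lt le_add_self h) with h' | h'
    · exact h'
    · exact absurd h' (lt_irrefl _)
  rw [min_eq_left ha.le, min_eq_left hb.le] at h ⊢
  have ha' : cnEDist c c' ≠ ⊤ := ne_top_of_lt ha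
  have hb' : cnEDist c' c'' ≠ ⊤ := ne_top_of_lt hb
  set a := (cnEDist c c').toReal with hadef
  set b := (cnEDist c' c'').toReal with hbdef
  have hae : cnEDist c c' = ENNReal.ofReal a := (ENNReal.ofReal_toReal ha').symm
  have hbe : cnEDist c' c'' = ENNReal.ofReal b := (ENNReal.ofReal_toReal hb').symm
  have ha0 : 0 ≤ a := ENNReal.toReal_nonneg
  have hb0 : 0 ≤ b := ENNReal.toReal_nonneg
  have hab : a + b < 1 := by
    have : ENNReal.ofReal a + ENNReal.ofReal b < 1 := by rwa [← hae, ← hbe]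
    rw [← ENNReal.ofReal_add ha0 hb0, ← ENNReal.ofReal_one, ENNReal.ofReal_lt_ofReal_iff'] at this
    exact this.1
  refine (min_le_left _ _).trans ?_
  rw [hae, hbe, ← ENNReal.ofReal_add ha0 hb0]
  refine (cnEDist_le_iff_forall_lt (add_nonneg ha0 hb0)).2 fun η hη ↦ ?_
  -- first reach the scale `η₁ = min η 1 ≤ 1`, then enlarge
  set η₁ := min η 1 with hη₁
  have hη₁ab : a + b < η₁ := lt_min hη hab
  have hη₁1 : η₁ ≤ 1 := min_le_right _ _
  set s := (η₁ - a - b) / 2 with hs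
  have hs0 : 0 < s := by rw [hs]; linarith
  have h1 : cnEDist c c' < ENNReal.ofReal (a + s) := by
    rw [hae]; exact (ENNReal.ofReal_lt_ofReal_iff (by linarith)).2 (by linarith)
  have h2 : cnEDist c' c'' < ENNReal.ofReal (b + s) := by
    rw [hbe]; exact (ENNReal.ofReal_lt_ofReal_iff (by linarith)).2 (by linarith)
  have hsum : a + s + (b + s) = η₁ := by rw [hs]; ring
  have hclose : IsClose η₁ c c'' := by
    rw [← hsum]
    exact (isClose_of_cnEDist_lt h1).trans (by linarith) (by linarith) (hsum.le.trans hη₁1)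
      (isClose_of_cnEDist_lt h2)
  exact hclose.mono (by linarith) (min_le_left _ _)

/-- The pseudo-extended-metric structure `min (d_CN) 1` (auxiliary; the instance below is the
pseudo-metric structure built from it, with the same `edist` and uniformity). [folklore] -/
abbrev pseudoEMetricAux : PseudoEMetricSpace (LoopConfig E) where
  edist c c' := min (cnEDist c c') 1
  edist_self c := by simp
  edist_comm c c' := by rw [cnEDist_comm]
  edist_triangle := min_cnEDist_one_triangle

/-- **The `d_CN` (pseudo-)metric structure on typed loop configurations**:
`edist F F' = min (d_CN(F, F')) 1`, `dist F F' = (min (d_CN(F, F')) 1).toReal`. Its topology and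
uniformity are those of the printed `d_CN` (`edist_lt_ofReal_iff`: below scale `1` the balls are
the printed ones). (DKKMO, arXiv:2012.11672v2, §1.2, "Define the metric on `C` …".) [cite: arXiv201211672v2, §1.2] -/
instance instPseudoMetricSpace : PseudoMetricSpace (LoopConfig E) :=
  @PseudoEMetricSpace.toPseudoMetricSpace _ pseudoEMetricAux
    fun c c' ↦ ne_top_of_le_ne_top ENNReal.one_ne_top (min_le_right (cnEDist c c') 1)

/-- Unfolding the extended distance: `edist F F' = min (d_CN(F, F')) 1`. [cite: arXiv201211672v2, §1.2] -/
theorem edist_def (c c' : LoopConfig E) : edist c c' = min (cnEDist c c') 1 := rfl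

/-- Unfolding the distance: `dist F F' = (min (d_CN(F, F')) 1).toReal`. [cite: arXiv201211672v2, §1.2] -/
theorem dist_def (c c' : LoopConfig E) : dist c c' = (min (cnEDist c c') 1).toReal := rfl

/-- The truncated distance is at most `1`. [folklore] -/
theorem edist_le_one (c c' : LoopConfig E) : edist c c' ≤ 1 := min_le_right _ _

/-- The truncated distance is at most `1`. [folklore] -/
theorem dist_le_one (c c' : LoopConfig E) : dist c c' ≤ 1 := by
  rw [dist_def, ← ENNReal.toReal_one]
  exact ENNReal.toReal_mono ENNReal.one_ne_top (min_le_right _ _)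

/-- `edist ≤ d_CN`. [folklore] -/
theorem edist_le_cnEDist (c c' : LoopConfig E) : edist c c' ≤ cnEDist c c' := min_le_left _ _

/-- **Below scale `1` the balls are the printed ones**: for `ε ≤ 1`,
`edist F F' < ε ↔ d_CN(F, F') < ε`. [cite: arXiv201211672v2, §1.2] -/
theorem edist_lt_ofReal_iff {c c' : LoopConfig E} {ε : ℝ} (hε : ε ≤ 1) :
    edist c c' < ENNReal.ofReal ε ↔ cnEDist c c' < ENNReal.ofReal ε := by
  rw [edist_def, min_lt_iff, or_iff_left]
  exact fun h ↦ absurd h (not_lt.2 (ENNReal.ofReal_le_one.2 hε))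

/-- For `ε ≤ 1`, `edist F F' < ε` implies the printed relation `d_CN(F, F') ≤ ε`. [cite: arXiv201211672v2, §1.2] -/
theorem isClose_of_edist_lt {c c' : LoopConfig E} {ε : ℝ} (hε : ε ≤ 1)
    (h : edist c c' < ENNReal.ofReal ε) : IsClose ε c c' :=
  isClose_of_cnEDist_lt ((edist_lt_ofReal_iff hε).1 h)

/-- The printed relation `d_CN(F, F') ≤ ε` (`ε > 0`) bounds the distance: `edist F F' ≤ ε`. [cite: arXiv201211672v2, §1.2] -/
theorem edist_le_ofReal_of_isClose {c c' : LoopConfig E} {ε : ℝ} (hε : 0 < ε)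
    (h : IsClose ε c c') : edist c c' ≤ ENNReal.ofReal ε :=
  (edist_le_cnEDist c c').trans (cnEDist_le hε h)

/-- The printed relation `d_CN(F, F') ≤ ε` (`ε > 0`) bounds the distance: `dist F F' ≤ ε`. [cite: arXiv201211672v2, §1.2] -/
theorem dist_le_of_isClose {c c' : LoopConfig E} {ε : ℝ} (hε : 0 < ε) (h : IsClose ε c c') :
    dist c c' ≤ ε := by
  rw [← ENNReal.ofReal_le_ofReal_iff hε.le, ← edist_dist]
  exact edist_le_ofReal_of_isClose hε h

/-- `edist F F' = 0 ↔ d_CN(F, F') = 0`. [folklore] -/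
theorem edist_eq_zero_iff {c c' : LoopConfig E} : edist c c' = 0 ↔ cnEDist c c' = 0 := by
  rw [edist_def]
  constructor
  · intro h
    rcases min_eq_iff.1 h with ⟨h', -⟩ | ⟨h', -⟩
    · exact h'
    · exact absurd h' one_ne_zero
  · intro h
    rw [h, min_eq_left zero_le_one]

/-- `d_CN(F, F') = 0` iff `d_CN(F, F') ≤ ε` in the printed sense for every `ε > 0`. [cite: arXiv201211672v2, §1.2] -/
theorem cnEDist_eq_zero_iff {c c' : LoopConfig E} :
    cnEDist c c' = 0 ↔ ∀ ε : ℝ, 0 < ε → IsClose ε c c' := by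
  rw [← nonpos_iff_eq_zero, ← ENNReal.ofReal_zero]
  exact cnEDist_le_iff_forall_lt le_rfl

/-- Two configurations are topologically indistinguishable iff `d_CN(F, F') = 0`. [folklore] -/
theorem inseparable_iff_cnEDist_eq_zero {c c' : LoopConfig E} :
    Inseparable c c' ↔ cnEDist c c' = 0 := by
  rw [EMetric.inseparable_iff, edist_eq_zero_iff]

/-! ### The Borel σ-algebra -/

/-- Typed loop configurations carry the Borel σ-algebra of the `d_CN` topology: laws of random
configurations are Borel measures on `LoopConfig E`. [folklore] -/
instance instMeasurableSpace : MeasurableSpace (LoopConfig E) := borel _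

/-- The σ-algebra on `LoopConfig E` is the Borel one. [folklore] -/
instance instBorelSpace : BorelSpace (LoopConfig E) := ⟨rfl⟩

/-! ### Reversal of members, local finiteness, and separation -/

/-- A configuration is *closed under reversal* if with every member it contains the reversed
loop. DKKMO's members are unoriented loops (compared through `d`, eq. (1)); an unoriented loop
is faithfully encoded by the pair `{u, u.reverse}`, so the reversal-closed configurations are
exactly the printed ones, with a unique encoding. [cite: arXiv201211672v2, §1.2] -/
def IsReversalClosed (c : LoopConfig E) : Prop := ∀ i, ∀ u ∈ c.F i, u.reverse ∈ c.F i

/-- The **reversal closure** of a configuration: add the reversals of all members (same types). [folklore] -/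
def reversalClosure (c : LoopConfig E) : LoopConfig E where
  F i := c.F i ∪ UnbasedLoop.reverse ⁻¹' c.F i

/-- Membership in the reversal closure. [folklore] -/
@[simp] theorem mem_reversalClosure_iff {c : LoopConfig E} {i : Fin 2} {u : UnbasedLoop E} :
    u ∈ c.reversalClosure.F i ↔ u ∈ c.F i ∨ u.reverse ∈ c.F i := Iff.rfl

/-- A configuration is contained in its reversal closure. [folklore] -/
theorem subset_reversalClosure (c : LoopConfig E) (i : Fin 2) : c.F i ⊆ c.reversalClosure.F i :=
  subset_union_left

/-- The reversal closure is closed under reversal. [folklore] -/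
theorem isReversalClosed_reversalClosure (c : LoopConfig E) : c.reversalClosure.IsReversalClosed := by
  intro i u hu
  rcases hu with hu | hu
  · exact Or.inr (by rwa [mem_preimage, UnbasedLoop.reverse_reverse])
  · exact Or.inl hu

/-- A reversal-closed configuration is its own reversal closure. [folklore] -/
theorem IsReversalClosed.reversalClosure_eq {c : LoopConfig E} (h : c.IsReversalClosed) :
    c.reversalClosure = c := by
  ext i u
  simp only [mem_reversalClosure_iff, or_iff_left_iff_imp]
  intro hu
  simpa using h i _ hu

/-- `d_CN ≤ ε` does not see the reversal closure (left argument): only the unoriented distance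
`d` is used. [folklore] -/
theorem isClose_reversalClosure_left {ε : ℝ} {c c' : LoopConfig E} :
    IsClose ε c.reversalClosure c' ↔ IsClose ε c c' := by
  constructor
  · intro h
    refine h.of_forall_mem_or_reverse_mem (fun i u hu ↦ Or.inl (Or.inl hu)) fun i u hu ↦ ?_
    rcases hu with hu | hu
    · exact Or.inl hu
    · exact Or.inr hu
  · intro h
    refine h.of_forall_mem_or_reverse_mem (fun i u hu ↦ ?_) fun i u hu ↦ Or.inl (Or.inl hu)
    rcases hu with hu | hu
    · exact Or.inl hu
    · exact Or.inr hu

/-- `d_CN ≤ ε` does not see the reversal closure (right argument). [folklore] -/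
theorem isClose_reversalClosure_right {ε : ℝ} {c c' : LoopConfig E} :
    IsClose ε c c'.reversalClosure ↔ IsClose ε c c' := by
  rw [isClose_comm, isClose_reversalClosure_left, isClose_comm]

/-- `d_CN` does not see the reversal closure (left argument). [folklore] -/
@[simp] theorem cnEDist_reversalClosure_left (c c' : LoopConfig E) :
    cnEDist c.reversalClosure c' = cnEDist c c' := by
  simp only [cnEDist, isClose_reversalClosure_left]

/-- `d_CN` does not see the reversal closure (right argument). [folklore] -/
@[simp] theorem cnEDist_reversalClosure_right (c c' : LoopConfig E) :
    cnEDist c c'.reversalClosure = cnEDist c c' := by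
  rw [cnEDist_comm, cnEDist_reversalClosure_left, cnEDist_comm]

/-- A configuration is at distance `0` from its reversal closure. [folklore] -/
@[simp] theorem edist_reversalClosure_eq_zero (c : LoopConfig E) : edist c.reversalClosure c = 0 := by
  rw [edist_eq_zero_iff, cnEDist_reversalClosure_left, cnEDist_self]

/-- **Local finiteness** of a typed configuration, in the form that `d_CN` sees and that survives
scaling limits: in every window `B(0, r)` only finitely many members of each type have a trace
of diameter `≥ ε`, for every `ε > 0` (Camia–Newman, CMP 268 (2006), §2: a.s. finitely many loops
of diameter `> ε` in any bounded region; DKKMO, arXiv:2012.11672v2, §1.2: "locally finite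
families" — a lattice configuration has finitely many interface loops inside any window, see
`IsLocallyFinite.of_finite_window`). Same reading as the tree's `LoopSpace.IsLocallyFinite`. [cite: arXiv201211672v2, §1.2] -/
def IsLocallyFinite (c : LoopConfig E) : Prop :=
  ∀ i (r ε : ℝ), 0 < ε → {u ∈ c.F i | u.range ⊆ ball (0 : E) r ∧ ε ≤ diam u.range}.Finite

/-- Configurations with finitely many members inside every window (e.g. the loop representation
of a lattice configuration at positive mesh) are locally finite. [folklore] -/
theorem IsLocallyFinite.of_finite_window {c : LoopConfig E}
    (h : ∀ i (r : ℝ), {u ∈ c.F i | u.range ⊆ ball (0 : E) r}.Finite) : c.IsLocallyFinite :=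
  fun i r _ _ ↦ (h i r).subset fun _ hu ↦ ⟨hu.1, hu.2.1⟩

/-- Configurations with finitely many members of each type are locally finite. [folklore] -/
theorem IsLocallyFinite.of_finite {c : LoopConfig E} (h : ∀ i, (c.F i).Finite) : c.IsLocallyFinite :=
  IsLocallyFinite.of_finite_window fun i _ ↦ (h i).subset fun _ hu ↦ hu.1

/-- Local finiteness passes to sub-configurations. [folklore] -/
theorem IsLocallyFinite.mono {c c' : LoopConfig E} (h : c.IsLocallyFinite) (h' : ∀ i, c'.F i ⊆ c.F i) :
    c'.IsLocallyFinite :=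
  fun i r ε hε ↦ (h i r ε hε).subset fun _ hu ↦ ⟨h' i hu.1, hu.2⟩

/-- The reversal closure of a locally finite configuration is locally finite. [folklore] -/
theorem IsLocallyFinite.reversalClosure {c : LoopConfig E} (h : c.IsLocallyFinite) :
    c.reversalClosure.IsLocallyFinite := by
  intro i r ε hε
  have himg : (UnbasedLoop.reverse '' {u ∈ c.F i | u.range ⊆ ball (0 : E) r ∧ ε ≤ diam u.range}).Finite :=
    (h i r ε hε).image _
  refine ((h i r ε hε).union himg).subset fun u hu ↦ ?_
  rcases hu.1 with h₁ | h₁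
  · exact Or.inl ⟨h₁, hu.2⟩
  · refine Or.inr ⟨u.reverse, ⟨h₁, ?_, ?_⟩, UnbasedLoop.reverse_reverse u⟩
    · simpa using hu.2.1
    · simpa using hu.2.2

/-- **Separation.** If `d_CN(F, F') = 0` and both configurations are reversal-closed, locally
finite and without point loops, then `F = F'`. A member `u` of `F` (diameter `δ > 0`, inside
`B(0, R)`) has for every small `ε` an `ε`-close partner of the same type in `F'`; partners lie
inside `B(0, R + 1)` and have diameter `≥ δ/2`, so range over a finite set, and a partner at
`d`-distance below the least positive value of `d(u, ·)` on that set is `u` or `u.reverse`. [folklore] -/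
theorem ext_of_cnEDist_eq_zero {c c' : LoopConfig E} (hc : c.IsReversalClosed)
    (hc' : c'.IsReversalClosed) (hf : c.IsLocallyFinite) (hf' : c'.IsLocallyFinite)
    (hn : ∀ i, ∀ u ∈ c.F i, u.range.Nontrivial) (hn' : ∀ i, ∀ u ∈ c'.F i, u.range.Nontrivial)
    (h : cnEDist c c' = 0) : c = c' := by
  -- one inclusion suffices, by symmetry
  suffices key : ∀ {c c' : LoopConfig E}, c'.IsReversalClosed → c'.IsLocallyFinite →
      (∀ i, ∀ u ∈ c.F i, u.range.Nontrivial) → cnEDist c c' = 0 → ∀ i, c.F i ⊆ c'.F i by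
    ext i u
    exact ⟨fun hu ↦ key hc' hf' hn h i hu, fun hu ↦ key hc hf hn' (by rwa [cnEDist_comm]) i hu⟩
  intro c c' hc' hf' hn h i u hu
  rw [cnEDist_eq_zero_iff] at h
  -- the window and the diameter of `u`
  obtain ⟨R, hR0, hR⟩ : ∃ R : ℝ, 0 < R ∧ u.range ⊆ ball (0 : E) R := by
    obtain ⟨R, hR⟩ := u.isCompact_range.isBounded.subset_ball (0 : E)
    exact ⟨max R 1, by positivity, hR.trans (ball_subset_ball (le_max_left _ _))⟩
  set δ := diam u.range with hδ
  have hδ0 : 0 < δ := diam_pos (hn i u hu) u.isCompact_range.isBounded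
  -- partners at scale `ε ≤ min (1/R) (δ/4)` lie in a finite set `T`
  set T := {v ∈ c'.F i | v.range ⊆ ball (0 : E) (R + 1) ∧ δ / 2 ≤ diam v.range} with hT
  have hTfin : T.Finite := hf' i (R + 1) (δ / 2) (by positivity)
  have partner : ∀ ε : ℝ, 0 < ε → ε ≤ 1 / R → ε ≤ δ / 4 → ε ≤ 1 →
      ∃ v ∈ T, u.udist v ≤ ε := by
    intro ε hε hεR hεδ hε1
    have hwin : u.range ⊆ ball (0 : E) (1 / ε) :=
      hR.trans (ball_subset_ball ((le_one_div hε hR0).1 hεR))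
    obtain ⟨v, hv, hd⟩ := (h ε hε i).1 u hu hwin
    refine ⟨v, ⟨hv, ?_, ?_⟩, hd⟩
    · exact (UnbasedLoop.range_subset_ball_of_udist_le hR hd).trans
        (ball_subset_ball (by linarith))
    · have := UnbasedLoop.diam_range_le_of_udist_le u v hd
      linarith
  -- if neither `u` nor `u.reverse` is in `F'`, all of `T` is at positive `d`-distance from `u`
  by_contra hu'
  have hur : u.reverse ∉ c'.F i := fun h' ↦ hu' (by simpa using hc' i _ h')
  have hpos : ∀ v ∈ T, 0 < u.udist v := by
    intro v hv
    refine lt_of_le_of_ne (UnbasedLoop.udist_nonneg u v) fun h0 ↦ ?_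
    rcases UnbasedLoop.udist_eq_zero_iff.1 h0.symm with rfl | rfl
    · exact hu' hv.1
    · exact hur hv.1
  -- a positive lower bound for `d(u, ·)` on the finite set `T`
  obtain ⟨η, hη0, hη⟩ : ∃ η : ℝ, 0 < η ∧ ∀ v ∈ T, η ≤ u.udist v := by
    rcases T.eq_empty_or_nonempty with hT0 | hTne
    · exact ⟨1, one_pos, by simp [hT0]⟩
    · obtain ⟨v₀, hv₀, hmin⟩ := hTfin.exists_minimalFor (fun v ↦ u.udist v) T hTne
      refine ⟨u.udist v₀, hpos v₀ hv₀, fun v hv ↦ ?_⟩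
      by_contra hlt
      push Not at hlt
      exact (lt_irrefl _) (lt_of_le_of_lt (hmin hv hlt.le) hlt)
  -- a partner at a scale below `η` contradicts the bound
  set ε := min (min (1 / R) (δ / 4)) (min 1 (η / 2)) with hε
  have hε0 : 0 < ε := by positivity
  obtain ⟨v, hvT, hd⟩ := partner ε hε0 ((min_le_left _ _).trans (min_le_left _ _))
    ((min_le_left _ _).trans (min_le_right _ _)) ((min_le_right _ _).trans (min_le_left _ _))
  have : ε ≤ η / 2 := (min_le_right _ _).trans (min_le_right _ _)
  linarith [hη v hvT]

end LoopConfig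

/-! ### Configurations modulo `d_CN = 0` -/

/-- **DKKMO's `(C, d_CN)` completed to a metric space of classes**: typed loop configurations
modulo `d_CN`-indistinguishability (`d_CN(F, F') = 0`, i.e. equality of the families up to
orientation of members and closure), with the metric `min (d_CN) 1`. A Hausdorff (metric) space
carrying the laws of random configurations and of their subsequential scaling limits; locally
finite configurations embed injectively (`LocFinLoopConfig.toCN_injective`). [folklore] -/
abbrev CNLoopSpace (E : Type*) [NormedAddCommGroup E] : Type _ := SeparationQuotient (LoopConfig E)

namespace LoopConfig

variable {E : Type*} [NormedAddCommGroup E]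

/-- The class of a configuration modulo `d_CN = 0`. [folklore] -/
def toCN (c : LoopConfig E) : CNLoopSpace E := SeparationQuotient.mk c

/-- `toCN` is Mathlib's `SeparationQuotient.mk`. [folklore] -/
theorem toCN_eq_mk (c : LoopConfig E) : c.toCN = SeparationQuotient.mk c := rfl

/-- `toCN` is surjective. [folklore] -/
theorem toCN_surjective : Function.Surjective (toCN : LoopConfig E → CNLoopSpace E) :=
  SeparationQuotient.surjective_mk

/-- Two configurations have the same class iff `d_CN(F, F') = 0`. [folklore] -/
theorem toCN_eq_toCN_iff {c c' : LoopConfig E} : c.toCN = c'.toCN ↔ cnEDist c c' = 0 := by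
  rw [toCN, toCN, SeparationQuotient.mk_eq_mk, inseparable_iff_cnEDist_eq_zero]

/-- `toCN` preserves the (extended) distance. [folklore] -/
@[simp] theorem edist_toCN (c c' : LoopConfig E) : edist c.toCN c'.toCN = edist c c' := rfl

/-- `toCN` preserves the distance. [folklore] -/
@[simp] theorem dist_toCN (c c' : LoopConfig E) : dist c.toCN c'.toCN = dist c c' := rfl

/-- `toCN` is an isometry. [folklore] -/
theorem isometry_toCN : Isometry (toCN : LoopConfig E → CNLoopSpace E) := fun _ _ ↦ rfl

/-- `toCN` is continuous. [folklore] -/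
theorem continuous_toCN : Continuous (toCN : LoopConfig E → CNLoopSpace E) :=
  isometry_toCN.continuous

/-- A configuration and its reversal closure have the same class. [folklore] -/
@[simp] theorem toCN_reversalClosure (c : LoopConfig E) : c.reversalClosure.toCN = c.toCN := by
  rw [toCN_eq_toCN_iff, cnEDist_reversalClosure_left, cnEDist_self]

end LoopConfig

namespace CNLoopSpace

variable {E : Type*} [NormedAddCommGroup E]

/-- Classes of configurations carry the Borel σ-algebra of the metric `min (d_CN) 1`. [folklore] -/
instance instMeasurableSpace : MeasurableSpace (CNLoopSpace E) := borel _

/-- The σ-algebra on `CNLoopSpace E` is the Borel one. [folklore] -/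
instance instBorelSpace : BorelSpace (CNLoopSpace E) := ⟨rfl⟩

/-- `toCN` is Borel measurable. [folklore] -/
theorem measurable_toCN : Measurable (LoopConfig.toCN : LoopConfig E → CNLoopSpace E) :=
  LoopConfig.continuous_toCN.measurable

/-- Distances of classes are at most `1`. [folklore] -/
theorem edist_le_one (x y : CNLoopSpace E) : edist x y ≤ 1 := by
  obtain ⟨c, rfl⟩ := LoopConfig.toCN_surjective x
  obtain ⟨c', rfl⟩ := LoopConfig.toCN_surjective y
  exact LoopConfig.edist_le_one c c'

end CNLoopSpace

/-! ### Locally finite configurations: a metric space under `min (d_CN) 1` -/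

/-- **DKKMO's space `C` of locally finite typed loop configurations** (arXiv:2012.11672v2, §1.2:
"the collection of sets `F = F₀ ⊔ F₁` of two locally finite families `F₀` and `F₁` of
non-self-crossing loops [...] that do not intersect each other"), as a metric space under the
(truncated) printed distance `d_CN`: a typed configuration (`LoopConfig E`) which is closed
under reversal of members (the faithful encoding of *unoriented* loops), has no point loops, and
is locally finite (in every window finitely many members of each type of diameter `≥ ε`,
`LoopConfig.IsLocallyFinite`). The non-crossing conditions of the paper are properties of
percolation configurations irrelevant to the metric structure and are not part of the type. On
this type `min (d_CN) 1` is a genuine metric (`instMetricSpace`, from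
`LoopConfig.ext_of_cnEDist_eq_zero`). [cite: arXiv201211672v2, §1.2] -/
structure LocFinLoopConfig (E : Type*) [NormedAddCommGroup E] extends LoopConfig E where
  /-- with every member the reversed loop is a member of the same type -/
  reverse_mem' : ∀ i, ∀ u ∈ F i, u.reverse ∈ F i
  /-- no member is a point loop -/
  nontrivial' : ∀ i, ∀ u ∈ F i, u.range.Nontrivial
  /-- in every window, finitely many members of each type of diameter `≥ ε` -/
  finite' : ∀ i (r ε : ℝ), 0 < ε → {u ∈ F i | u.range ⊆ ball (0 : E) r ∧ ε ≤ diam u.range}.Finite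

namespace LocFinLoopConfig

variable {E : Type*} [NormedAddCommGroup E]

/-- The underlying configuration is reversal-closed. [folklore] -/
theorem isReversalClosed (c : LocFinLoopConfig E) : c.toLoopConfig.IsReversalClosed := c.reverse_mem'

/-- The underlying configuration is locally finite. [folklore] -/
theorem isLocallyFinite (c : LocFinLoopConfig E) : c.toLoopConfig.IsLocallyFinite := c.finite'

/-- Members are not point loops. [folklore] -/
theorem range_nontrivial (c : LocFinLoopConfig E) {i : Fin 2} {u : UnbasedLoop E} (hu : u ∈ c.F i) :
    u.range.Nontrivial :=
  c.nontrivial' i u hu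

/-- `toLoopConfig` is injective (the extra fields are propositions). [folklore] -/
theorem toLoopConfig_injective : Function.Injective (toLoopConfig : LocFinLoopConfig E → LoopConfig E) := by
  rintro ⟨c, _, _, _⟩ ⟨c', _, _, _⟩ h
  congr

/-- Extensionality: locally finite configurations with the same families are equal. [folklore] -/
@[ext] theorem ext {c c' : LocFinLoopConfig E} (h : ∀ i, c.F i = c'.F i) : c = c' :=
  toLoopConfig_injective (LoopConfig.ext (funext h))

/-- **`min (d_CN) 1` is a metric on locally finite configurations** (pseudo-metric structure
induced from `LoopConfig E`, separation by `LoopConfig.ext_of_cnEDist_eq_zero`). [cite: arXiv201211672v2, §1.2] -/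
instance instMetricSpace : MetricSpace (LocFinLoopConfig E) where
  toPseudoMetricSpace := PseudoMetricSpace.induced toLoopConfig inferInstance
  eq_of_dist_eq_zero {c c'} h := by
    have h0 : edist c.toLoopConfig c'.toLoopConfig = 0 := by
      have h' : dist c.toLoopConfig c'.toLoopConfig = 0 := h
      rw [edist_dist, h', ENNReal.ofReal_zero]
    exact toLoopConfig_injective <| LoopConfig.ext_of_cnEDist_eq_zero c.isReversalClosed
      c'.isReversalClosed c.isLocallyFinite c'.isLocallyFinite c.nontrivial' c'.nontrivial'
      (LoopConfig.edist_eq_zero_iff.1 h0)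

/-- The distance of locally finite configurations is that of the underlying configurations. [folklore] -/
@[simp] theorem edist_toLoopConfig (c c' : LocFinLoopConfig E) :
    edist c.toLoopConfig c'.toLoopConfig = edist c c' := rfl

/-- The distance of locally finite configurations is that of the underlying configurations. [folklore] -/
@[simp] theorem dist_toLoopConfig (c c' : LocFinLoopConfig E) :
    dist c.toLoopConfig c'.toLoopConfig = dist c c' := rfl

/-- Unfolding the distance: `edist F F' = min (d_CN(F, F')) 1`. [cite: arXiv201211672v2, §1.2] -/
theorem edist_def (c c' : LocFinLoopConfig E) :
    edist c c' = min (LoopConfig.cnEDist c.toLoopConfig c'.toLoopConfig) 1 := rfl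

/-- `toLoopConfig` is an isometry (an isometric embedding of `C` into all configurations). [folklore] -/
theorem isometry_toLoopConfig : Isometry (toLoopConfig : LocFinLoopConfig E → LoopConfig E) :=
  fun _ _ ↦ rfl

/-- `toLoopConfig` is an embedding. [folklore] -/
theorem isEmbedding_toLoopConfig : Topology.IsEmbedding (toLoopConfig : LocFinLoopConfig E → LoopConfig E) :=
  isometry_toLoopConfig.isEmbedding

/-- `toLoopConfig` is continuous. [folklore] -/
theorem continuous_toLoopConfig : Continuous (toLoopConfig : LocFinLoopConfig E → LoopConfig E) :=
  isometry_toLoopConfig.continuous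

/-- **On `C` two configurations are equal iff `d_CN(F, F') = 0`.** [cite: arXiv201211672v2, §1.2] -/
theorem cnEDist_eq_zero_iff {c c' : LocFinLoopConfig E} :
    LoopConfig.cnEDist c.toLoopConfig c'.toLoopConfig = 0 ↔ c = c' := by
  rw [← LoopConfig.edist_eq_zero_iff, edist_toLoopConfig, edist_eq_zero]

/-- For `ε ≤ 1`, `edist F F' < ε` iff `d_CN(F, F') < ε`. [cite: arXiv201211672v2, §1.2] -/
theorem edist_lt_ofReal_iff {c c' : LocFinLoopConfig E} {ε : ℝ} (hε : ε ≤ 1) :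
    edist c c' < ENNReal.ofReal ε ↔
      LoopConfig.cnEDist c.toLoopConfig c'.toLoopConfig < ENNReal.ofReal ε :=
  LoopConfig.edist_lt_ofReal_iff hε

/-- For `ε ≤ 1`, `edist F F' < ε` implies the printed relation `d_CN(F, F') ≤ ε`. [cite: arXiv201211672v2, §1.2] -/
theorem isClose_of_edist_lt {c c' : LocFinLoopConfig E} {ε : ℝ} (hε : ε ≤ 1)
    (h : edist c c' < ENNReal.ofReal ε) : LoopConfig.IsClose ε c.toLoopConfig c'.toLoopConfig :=
  LoopConfig.isClose_of_edist_lt hε h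

/-- The printed relation `d_CN(F, F') ≤ ε` (`ε > 0`) gives `dist F F' ≤ ε`. [cite: arXiv201211672v2, §1.2] -/
theorem dist_le_of_isClose {c c' : LocFinLoopConfig E} {ε : ℝ} (hε : 0 < ε)
    (h : LoopConfig.IsClose ε c.toLoopConfig c'.toLoopConfig) : dist c c' ≤ ε :=
  LoopConfig.dist_le_of_isClose hε h

/-- Locally finite configurations carry the Borel σ-algebra of `d_CN`. [folklore] -/
instance instMeasurableSpace : MeasurableSpace (LocFinLoopConfig E) := borel _

/-- The σ-algebra on `LocFinLoopConfig E` is the Borel one. [folklore] -/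
instance instBorelSpace : BorelSpace (LocFinLoopConfig E) := ⟨rfl⟩

/-- `toLoopConfig` is Borel measurable. [folklore] -/
theorem measurable_toLoopConfig : Measurable (toLoopConfig : LocFinLoopConfig E → LoopConfig E) :=
  continuous_toLoopConfig.measurable

/-- The class of a locally finite configuration modulo `d_CN = 0`. [folklore] -/
def toCN (c : LocFinLoopConfig E) : CNLoopSpace E := c.toLoopConfig.toCN

/-- Unfolding `toCN`. [folklore] -/
theorem toCN_def (c : LocFinLoopConfig E) : c.toCN = c.toLoopConfig.toCN := rfl

/-- `toCN` is an isometry. [folklore] -/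
theorem isometry_toCN : Isometry (toCN : LocFinLoopConfig E → CNLoopSpace E) := fun _ _ ↦ rfl

/-- **Locally finite configurations embed in the space of classes**: `toCN` is injective. [folklore] -/
theorem toCN_injective : Function.Injective (toCN : LocFinLoopConfig E → CNLoopSpace E) :=
  isometry_toCN.injective

/-- `toCN` is continuous. [folklore] -/
theorem continuous_toCN : Continuous (toCN : LocFinLoopConfig E → CNLoopSpace E) :=
  isometry_toCN.continuous

/-- `toCN` is Borel measurable. [folklore] -/
theorem measurable_toCN : Measurable (toCN : LocFinLoopConfig E → CNLoopSpace E) :=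
  continuous_toCN.measurable

/-- **Constructor**: the reversal closure of a locally finite configuration without point loops
(e.g. the loop representation of a lattice configuration, entered with one orientation per
loop) is a point of `C`. [folklore] -/
def ofLoopConfig (c : LoopConfig E) (hf : c.IsLocallyFinite) (hn : ∀ i, ∀ u ∈ c.F i, u.range.Nontrivial) :
    LocFinLoopConfig E where
  toLoopConfig := c.reversalClosure
  reverse_mem' := c.isReversalClosed_reversalClosure
  nontrivial' i u hu := by
    rcases hu with hu | hu
    · exact hn i u hu
    · simpa using hn i _ hu
  finite' := hf.reversalClosure

/-- The underlying configuration of `ofLoopConfig c` is the reversal closure of `c`. [folklore] -/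
@[simp] theorem toLoopConfig_ofLoopConfig (c : LoopConfig E) (hf : c.IsLocallyFinite)
    (hn : ∀ i, ∀ u ∈ c.F i, u.range.Nontrivial) :
    (ofLoopConfig c hf hn).toLoopConfig = c.reversalClosure := rfl

/-- `ofLoopConfig c` is at distance `0` from `c`: closeness statements about `c` (e.g. DKKMO's
theorems for `bondLoopConfig`) transfer verbatim. [folklore] -/
@[simp] theorem edist_ofLoopConfig_eq_zero (c : LoopConfig E) (hf : c.IsLocallyFinite)
    (hn : ∀ i, ∀ u ∈ c.F i, u.range.Nontrivial) :
    edist (ofLoopConfig c hf hn).toLoopConfig c = 0 :=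
  c.edist_reversalClosure_eq_zero

/-- `d_CN ≤ ε` between constructed points of `C` is `d_CN ≤ ε` between the raw configurations. [folklore] -/
theorem isClose_ofLoopConfig_iff {ε : ℝ} {c c' : LoopConfig E} {hf : c.IsLocallyFinite}
    {hn : ∀ i, ∀ u ∈ c.F i, u.range.Nontrivial} {hf' : c'.IsLocallyFinite}
    {hn' : ∀ i, ∀ u ∈ c'.F i, u.range.Nontrivial} :
    LoopConfig.IsClose ε (ofLoopConfig c hf hn).toLoopConfig (ofLoopConfig c' hf' hn').toLoopConfig ↔
      LoopConfig.IsClose ε c c' := by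
  rw [toLoopConfig_ofLoopConfig, toLoopConfig_ofLoopConfig, LoopConfig.isClose_reversalClosure_left,
    LoopConfig.isClose_reversalClosure_right]

/-- The class of `ofLoopConfig c` is the class of `c`. [folklore] -/
@[simp] theorem toCN_ofLoopConfig (c : LoopConfig E) (hf : c.IsLocallyFinite)
    (hn : ∀ i, ∀ u ∈ c.F i, u.range.Nontrivial) : (ofLoopConfig c hf hn).toCN = c.toCN :=
  c.toCN_reversalClosure

end LocFinLoopConfig

/-! ### Laws: the coupling distance of eq. (2) dominates the Lévy–Prokhorov distance -/

namespace LoopConfig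

variable {E : Type*} [NormedAddCommGroup E]
variable {Ω Ω' : Type*} [MeasurableSpace Ω] [MeasurableSpace Ω']

/-- **DKKMO's coupling distance dominates the Lévy–Prokhorov distance of the laws** (on
`LoopConfig E` with the `d_CN` pseudo-metric): a coupling `P` of `μ` and `μ'` with
`P[d_CN(X, X') > ε] < ε` gives, for every Borel `B`, `μ[X ∈ B] ≤ μ'[X' ∈ B^η] + η` for all
`η > ε` (Dudley, *Real Analysis and Probability*, Thm. 11.3.5: Prokhorov `≤` Ky Fan). Hence
`cnLawEDist → 0` along a family of pairs of laws forces their Lévy–Prokhorov distance to `0`,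
and Lévy–Prokhorov convergence implies weak convergence
(`MeasureTheory.LevyProkhorov.le_convergenceInDistribution`). [folklore] -/
theorem levyProkhorovEDist_map_le_cnLawEDist {μ : Measure Ω} {μ' : Measure Ω'}
    {X : Ω → LoopConfig E} {X' : Ω' → LoopConfig E} (hX : Measurable X) (hX' : Measurable X') :
    levyProkhorovEDist (μ.map X) (μ'.map X') ≤ cnLawEDist μ X μ' X' := by
  refine levyProkhorovEDist_le_of_forall _ _ _ fun η B hη hηtop hB ↦ ?_
  obtain ⟨ε, -, hε, hεη⟩ := ENNReal.lt_iff_exists_real_btwn.1 hη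
  obtain ⟨P, h₁, h₂, hP⟩ := exists_coupling_of_cnLawEDist_lt hε
  have hε0 : 0 < ε := ENNReal.ofReal_pos.1 (lt_of_le_of_lt bot_le hε)
  have hηreal : ENNReal.ofReal η.toReal = η := ENNReal.ofReal_toReal hηtop.ne
  have hBt : MeasurableSet (thickening η.toReal B) := isOpen_thickening.measurableSet
  -- off the exceptional set, `X'` is `η`-close to `X` (and conversely)
  have close : ∀ p : Ω × Ω', IsClose ε (X p.1) (X' p.2) → edist (X p.1) (X' p.2) < η := fun p hp ↦
    lt_of_le_of_lt (edist_le_ofReal_of_isClose hε0 hp) hεη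
  have hPN : P {p | ¬ IsClose ε (X p.1) (X' p.2)} ≤ η := hP.le.trans hεη.le
  constructor
  · rw [Measure.map_apply hX hB, Measure.map_apply hX' hBt, ← h₁, ← h₂,
      Measure.map_apply measurable_fst (hX hB), Measure.map_apply measurable_snd (hX' hBt)]
    calc P (Prod.fst ⁻¹' (X ⁻¹' B))
        ≤ P (Prod.snd ⁻¹' (X' ⁻¹' thickening η.toReal B) ∪ {p | ¬ IsClose ε (X p.1) (X' p.2)}) := by
          refine measure_mono fun p hp ↦ ?_
          by_cases hc : IsClose ε (X p.1) (X' p.2)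
          · left
            simp only [mem_preimage, mem_thickening_iff_exists_edist_lt]
            exact ⟨X p.1, hp, by rw [edist_comm, hηreal]; exact close p hc⟩
          · exact Or.inr hc
      _ ≤ P (Prod.snd ⁻¹' (X' ⁻¹' thickening η.toReal B)) + P {p | ¬ IsClose ε (X p.1) (X' p.2)} :=
          measure_union_le _ _
      _ ≤ P (Prod.snd ⁻¹' (X' ⁻¹' thickening η.toReal B)) + η := add_le_add le_rfl hPN
  · rw [Measure.map_apply hX' hB, Measure.map_apply hX hBt, ← h₁, ← h₂,
      Measure.map_apply measurable_snd (hX' hB), Measure.map_apply measurable_fst (hX hBt)]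
    calc P (Prod.snd ⁻¹' (X' ⁻¹' B))
        ≤ P (Prod.fst ⁻¹' (X ⁻¹' thickening η.toReal B) ∪ {p | ¬ IsClose ε (X p.1) (X' p.2)}) := by
          refine measure_mono fun p hp ↦ ?_
          by_cases hc : IsClose ε (X p.1) (X' p.2)
          · left
            simp only [mem_preimage, mem_thickening_iff_exists_edist_lt]
            exact ⟨X' p.2, hp, by rw [hηreal]; exact close p hc⟩
          · exact Or.inr hc
      _ ≤ P (Prod.fst ⁻¹' (X ⁻¹' thickening η.toReal B)) + P {p | ¬ IsClose ε (X p.1) (X' p.2)} :=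
          measure_union_le _ _
      _ ≤ P (Prod.fst ⁻¹' (X ⁻¹' thickening η.toReal B)) + η := add_le_add le_rfl hPN

/-- The Lévy–Prokhorov distance does not increase under push-forward along the quotient map
`toCN` (an edistance-preserving surjection pulls thickenings back to thickenings). [folklore] -/
theorem levyProkhorovEDist_map_toCN_le (ν ν' : Measure (LoopConfig E)) :
    levyProkhorovEDist (ν.map toCN) (ν'.map toCN) ≤ levyProkhorovEDist ν ν' := by
  have hm : Measurable (toCN : LoopConfig E → CNLoopSpace E) := CNLoopSpace.measurable_toCN
  have hpre : ∀ (r : ℝ) (B : Set (CNLoopSpace E)), toCN ⁻¹' thickening r B = thickening r (toCN ⁻¹' B) := by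
    intro r B
    ext c
    simp only [mem_preimage, mem_thickening_iff_exists_edist_lt]
    constructor
    · rintro ⟨y, hy, hd⟩
      obtain ⟨c', rfl⟩ := toCN_surjective y
      exact ⟨c', hy, hd⟩
    · rintro ⟨c', hc', hd⟩
      exact ⟨c'.toCN, hc', hd⟩
  refine levyProkhorovEDist_le_of_forall _ _ _ fun η B hη _ hB ↦ ?_
  have hBt : MeasurableSet (thickening η.toReal B) := isOpen_thickening.measurableSet
  rw [Measure.map_apply hm hB, Measure.map_apply hm hB, Measure.map_apply hm hBt, Measure.map_apply hm hBt,
    hpre]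
  exact ⟨left_measure_le_of_levyProkhorovEDist_lt hη (hm hB),
    right_measure_le_of_levyProkhorovEDist_lt hη (hm hB)⟩

/-- **DKKMO's coupling distance dominates the Lévy–Prokhorov distance of the laws on the metric
space `CNLoopSpace E`** of classes of configurations: with `LevyProkhorov.le_convergenceInDistribution`
this is the form in which `d_CN`-closeness of lattice laws (DKKMO Theorems 1.2, 1.7, 1.9, through
`cnLawEDist`) identifies subsequential weak limits, and Prokhorov's theorem
(`isCompact_closure_of_isTightMeasureSet`) applies on this Hausdorff space. [folklore] -/
theorem levyProkhorovEDist_map_toCN_le_cnLawEDist {μ : Measure Ω} {μ' : Measure Ω'}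
    {X : Ω → LoopConfig E} {X' : Ω' → LoopConfig E} (hX : Measurable X) (hX' : Measurable X') :
    levyProkhorovEDist (μ.map (toCN ∘ X)) (μ'.map (toCN ∘ X')) ≤ cnLawEDist μ X μ' X' := by
  have hm : Measurable (toCN : LoopConfig E → CNLoopSpace E) := CNLoopSpace.measurable_toCN
  rw [← Measure.map_map hm hX, ← Measure.map_map hm hX']
  exact (levyProkhorovEDist_map_toCN_le _ _).trans (levyProkhorovEDist_map_le_cnLawEDist hX hX')

end LoopConfig

end Literature.Probability.RandomPlanarGeometry

end
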